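import Literature.AnabelianGeometry.EtaleTheta.BiKummerOfModel
import Literature.AnabelianGeometry.EtaleTheta.Discharge.Sec4Prop42
import Literature.AnabelianGeometry.EtaleTheta.Discharge.Sec4BiKummerRoots
import Literature.AlgebraicGeometry.Frobenioids.PerfFactorialCoprime

/-!
# [EtTh] Prop 4.2 (i), (ii) and Prop 4.3 (iii) for the model instance of the §4 setting (`BiKummerSetting.mkOfModel`)

Mochizuki, *The étale theta function …*, Publ. RIMS **45** (2009), §4, Prop. 4.2 (i)(ii), PDF p.88
[cite: MochizukiEtTh2009, Prop 4.2 p.88].  abc-iut cell, layer L2, ROW `EtTh:Prop4.2` (seat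
abc-iut-L6-t12).  For abc-iut-L2-t9's instantiation `BiKummerSetting.mkOfModel` of the §4 setting
(`BiKummerOfModel.lean`: `O^×(A^birat) := B(A_D)^×`, `s' · (s'')⁻¹ := u_{s'} · u_{s''}⁻¹`, restriction =
transport along `Base(s)⁻¹` — [FrdI] Thm. 5.2 (ii)), the dictionary hypotheses of
`Discharge/Sec4Prop42.lean` hold with `toB = id`, so Prop. 4.2 (i) and (ii) hold for the model outright,
given `Φ` divisorial ([FrdI] Thm. 5.2 (ii); `B` is group-like because `B₀^Λ` is, `isGroupLike_ratFnFunctor`)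
and the two laws of the (still abstract) disjoint-supports predicate `DS` ([FrdI] Prop. 4.1 (iii)); likewise Prop. 4.3 (iii) (first clause, as
typed: the difference of the two sections of a bi-Kummer root is `μ_N(B_N)`-valued) holds for the model
given `Φ` divisorial (see `Discharge/Sec4BiKummerRoots.lean`; the section property of `s_N^triv` is the
field `autBase_striv` of the v2 statement file).  Nothing here asserts that such data exist for an actual
curve.
-/

noncomputable section

namespace Literature.AnabelianGeometry.EtaleTheta

open CategoryTheory Opposite Literature.AlgebraicGeometry.Frobenioids
open Literature.AlgebraicGeometry.Frobenioids.PreFrobenioid (pull_pull_inv_eq pull_injective)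

universe u₀ v₀ u v w

variable {K : Type u₀} [Field K]

namespace BiKummerSetting

variable (X : SemiGraphs.TemperedArithmeticGroup.{u₀} K) {D₀ : Type u₀} [Category.{v₀} D₀]
  {V : FrdIMonoidStub.{w}} {T : RealifiedDivisorMonoids (D₀ := D₀) V} {D : Type u} [Category.{v} D]
  {VD : FrdICatStub.{u, v, w} D}

/-- A commutative monoid all of whose elements are units is group-like ([FrdI] Def. 1.1 (i): integral,
saturated, of characteristic type, `M^char = 0`).  (Same lemma as abc-iut-L1-d10's private copy in
`PadicFrobenioidIsotropic.lean`; kept private here as well.) [cite: MochizukiFrdI2008, Def. 1.1 (i) p.19] -/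
private theorem isGroupLike_of_forall_isUnit' {M : Type w} [CommMonoid M] (h : ∀ b : M, IsUnit b) :
    IsGroupLike M := by
  haveI : IsCancelMul M :=
    { mul_left_cancel := fun a b c habc => (h a).mul_left_cancel habc
      mul_right_cancel := fun a b c habc => (h a).mul_right_cancel habc }
  refine ⟨⟨isIntegral_iff_isCancelMul.mpr inferInstance, ⟨fun x n _ _ => ?_⟩, ⟨fun u a hua => ?_⟩⟩,
    ⟨fun x y => ?_⟩⟩
  · obtain ⟨a, b, hab⟩ := gp_exists_mul_of_eq_of x
    obtain ⟨v, hv⟩ := h b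
    refine ⟨a * ↑v⁻¹, ?_⟩
    rw [map_mul, map_units_inv, hv, mul_inv_eq_iff_eq_mul]
    exact hab.symm
  · have : (u : M) * a = 1 * a := by rw [hua, one_mul]
    exact Units.ext ((h a).mul_right_cancel this)
  · obtain ⟨a, rfl⟩ := Associates.mk_surjective x
    obtain ⟨b, rfl⟩ := Associates.mk_surjective y
    obtain ⟨ua, hua⟩ := h a
    obtain ⟨ub, hub⟩ := h b
    exact Associates.mk_eq_mk_iff_associated.mpr ⟨ua⁻¹ * ub, by
      rw [← hua, Units.val_mul, ← mul_assoc, Units.mul_inv, one_mul, hub]⟩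

/-- **`B` is group-like** for the tempered Frobenioid when `B₀^Λ` is (abc-iut-L2-t9's `isUnit_ratFn`): the
hypothesis "`B` a group-like monoid on `D`" of [FrdI] Thm. 5.2 (ii) holds for `C = tf.category`.
[cite: MochizukiEtTh2009, Def 3.6 p.77] -/
theorem _root_.Literature.AnabelianGeometry.EtaleTheta.TemperedFrobenioid.isGroupLike_ratFnFunctor
    (tf : TemperedFrobenioid T D VD) (hBΛ : ∀ (Y : D₀ᵒᵖ) (b : T.BΛ.obj Y), IsUnit b) :
    Objectwise (fun M _ => IsGroupLike M) tf.ratFnFunctor :=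
  fun _ => isGroupLike_of_forall_isUnit' fun b => tf.isUnit_ratFn (hBΛ _) b

/-- The fraction of `mkOfModel` satisfies the dictionary identity with `toB = id`:
`(s' · (s'')⁻¹) · u_{s''} = u_{s'}` in `B(A_D)`. [cite: MochizukiEtTh2009, Def 4.1 p.86] -/
theorem coe_fracOfModel_mul_unit (tf : TemperedFrobenioid T D VD)
    (hBΛ : ∀ (Y : D₀ᵒᵖ) (b : T.BΛ.obj Y), IsUnit b) {A B : tf.category} (s' s'' : A ⟶ B) :
    ((tf.fracOfModel hBΛ s' s'' : tf.biratUnitsModel A) : tf.ratFnFunctor.obj (op A.base)) *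
      ModelFrobenioid.unit s'' = ModelFrobenioid.unit s' := by
  rw [TemperedFrobenioid.coe_fracOfModel, mul_assoc, Units.inv_mul_of_eq (IsUnit.unit_spec _), mul_one]

/-- Restriction along a pre-step in `mkOfModel` is undone by pull-back: `Base(s)^* (f|_B) = f` in
`B(A_D)`. [cite: MochizukiEtTh2009, Def 4.1 p.86] -/
theorem pull_coe_restrictAlongModel (tf : TemperedFrobenioid T D VD) {A B : tf.category} (s : A ⟶ B)
    (hs : PreFrobenioid.IsPreStep tf.toElem s) (x : tf.biratUnitsModel A) :
    pull tf.ratFnFunctor (ModelFrobenioid.baseMap s)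
      ((tf.restrictAlongModel s hs x : tf.biratUnitsModel B) : tf.ratFnFunctor.obj (op B.base)) =
      (x : tf.ratFnFunctor.obj (op A.base)) := by
  haveI : IsIso (ModelFrobenioid.baseMap s) := hs.2
  rw [TemperedFrobenioid.coe_restrictAlongModel_apply]
  exact pull_pull_inv_eq _ _

/-- **[EtTh] Prop. 4.2 (i) for the model instance** `mkOfModel` of the §4 setting: holds given `Φ`
divisorial (`B` is group-like since `B₀^Λ` is) and the cancellation law of the disjoint-supports predicate `DS`
([FrdI] Prop. 4.1 (iii)). [cite: MochizukiEtTh2009, Prop 4.2(i) p.88] -/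
theorem prop42_i_mkOfModel (tf : TemperedFrobenioid T D VD) (hZ : tf.monoidType = MonoidType.Z)
    (hP : ∀ A : Dᵒᵖ, IsPerfect (tf.Φ.carrier A)) (hBΛ : ∀ (Y : D₀ᵒᵖ) (b : T.BΛ.obj Y), IsUnit b)
    (DS : ∀ {A : Dᵒᵖ}, tf.Φ.carrier A → tf.Φ.carrier A → Prop) (IG : D → Prop)
    (gS : ∀ A : D, IG A → (X.Pi →* Aut A)) (gSs : ∀ (A : D) (h : IG A), Function.Surjective (gS A h))
    (NH : Subgroup (Field.absoluteGaloisGroup K) → tf.category → ℕ+ → Prop)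
    (AB : ∀ {A B : tf.category}, Subgroup (Aut A) → (A ⟶ A) → (A ⟶ B) → Prop) (A₀ : tf.category)
    (hA₀ : PreFrobenioid.IsFrobeniusTrivial tf.toElem A₀) (hA₀' : IG A₀.base)
    (hΦd : Objectwise (fun M _ => IsDivisorial M) tf.divisorMonoid)
    (hDS : ∀ {A : Dᵒᵖ} {a b a' b' : tf.Φ.carrier A}, DS a b → DS a' b' → a * b' = a' * b →
      a = a' ∧ b = b') :
    (mkOfModel X tf hZ hP hBΛ DS IG gS gSs NH AB A₀ hA₀ hA₀').Prop42_i := by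
  refine prop42_i_of _ hΦd (tf.isGroupLike_ratFnFunctor hBΛ) (fun A => MonoidHom.id (tf.biratUnitsModel A))
    ?_ ?_ hDS
  · intro A a b h
    exact h
  · intro A B s' s'' h' h'' hb
    exact coe_fracOfModel_mul_unit tf hBΛ s' s''

/-- **[EtTh] Prop. 4.2 (ii) for the model instance** `mkOfModel` of the §4 setting (necessity and
uniqueness, as typed): holds given `Φ` divisorial and the cancellation and transport
laws of the disjoint-supports predicate `DS` ([FrdI] Prop. 4.1 (iii)). [cite: MochizukiEtTh2009, Prop 4.2(ii) p.88] -/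
theorem prop42_ii_mkOfModel (tf : TemperedFrobenioid T D VD) (hZ : tf.monoidType = MonoidType.Z)
    (hP : ∀ A : Dᵒᵖ, IsPerfect (tf.Φ.carrier A)) (hBΛ : ∀ (Y : D₀ᵒᵖ) (b : T.BΛ.obj Y), IsUnit b)
    (DS : ∀ {A : Dᵒᵖ}, tf.Φ.carrier A → tf.Φ.carrier A → Prop) (IG : D → Prop)
    (gS : ∀ A : D, IG A → (X.Pi →* Aut A)) (gSs : ∀ (A : D) (h : IG A), Function.Surjective (gS A h))
    (NH : Subgroup (Field.absoluteGaloisGroup K) → tf.category → ℕ+ → Prop)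
    (AB : ∀ {A B : tf.category}, Subgroup (Aut A) → (A ⟶ A) → (A ⟶ B) → Prop) (A₀ : tf.category)
    (hA₀ : PreFrobenioid.IsFrobeniusTrivial tf.toElem A₀) (hA₀' : IG A₀.base)
    (hΦd : Objectwise (fun M _ => IsDivisorial M) tf.divisorMonoid)
    (hDS : ∀ {A : Dᵒᵖ} {a b a' b' : tf.Φ.carrier A}, DS a b → DS a' b' → a * b' = a' * b →
      a = a' ∧ b = b')
    (hDSι : ∀ {A A' : D} (e : A' ⟶ A) [IsIso e] {a b : tf.Φ.carrier (op A)}, DS a b →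
      DS (pull tf.divisorMonoid e a) (pull tf.divisorMonoid e b)) :
    (mkOfModel X tf hZ hP hBΛ DS IG gS gSs NH AB A₀ hA₀ hA₀').Prop42_ii := by
  refine prop42_ii_of _ hΦd (tf.isGroupLike_ratFnFunctor hBΛ) (fun A => MonoidHom.id (tf.biratUnitsModel A))
    ?_ ?_ hDS hDSι
  · intro A B s' s'' h' h'' hb
    exact coe_fracOfModel_mul_unit tf hBΛ s' s''
  · intro A B s hs x
    exact pull_coe_restrictAlongModel tf s hs x

/-- The `Aut_C(A)`-action of `mkOfModel` on `O^×(A^birat) = B(A_D)^×` is transport along `Base(σ⁻¹)`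
(the dictionary law `haut` with `toB = id`). [cite: MochizukiEtTh2009, Def 4.1 p.87] -/
theorem coe_biratAutModel_eq_pull (tf : TemperedFrobenioid T D VD) {A : tf.category} (σ : Aut A)
    (x : tf.biratUnitsModel A) :
    ((tf.biratAutModel A σ x : tf.biratUnitsModel A) : tf.ratFnFunctor.obj (op A.base)) =
      pull tf.ratFnFunctor (ModelFrobenioid.baseMap σ.inv) (x : tf.ratFnFunctor.obj (op A.base)) :=
  TemperedFrobenioid.coe_biratAutModel_apply tf A σ x

/-- **[EtTh] Prop. 4.3 (iii) (first clause, as typed) for the model instance** `mkOfModel` of the §4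
setting: the difference `s'^{gp}(h) · s''^{gp}(h)⁻¹` of the two sections of any bi-Kummer root is
`μ_N(B_N)`-valued, given only `Φ` divisorial. [cite: MochizukiEtTh2009, Prop 4.3(iii) p.91] -/
theorem prop43_iii_mkOfModel (tf : TemperedFrobenioid T D VD) (hZ : tf.monoidType = MonoidType.Z)
    (hP : ∀ A : Dᵒᵖ, IsPerfect (tf.Φ.carrier A)) (hBΛ : ∀ (Y : D₀ᵒᵖ) (b : T.BΛ.obj Y), IsUnit b)
    (DS : ∀ {A : Dᵒᵖ}, tf.Φ.carrier A → tf.Φ.carrier A → Prop) (IG : D → Prop)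
    (gS : ∀ A : D, IG A → (X.Pi →* Aut A)) (gSs : ∀ (A : D) (h : IG A), Function.Surjective (gS A h))
    (NH : Subgroup (Field.absoluteGaloisGroup K) → tf.category → ℕ+ → Prop)
    (AB : ∀ {A B : tf.category}, Subgroup (Aut A) → (A ⟶ A) → (A ⟶ B) → Prop) (A₀ : tf.category)
    (hA₀ : PreFrobenioid.IsFrobeniusTrivial tf.toElem A₀) (hA₀' : IG A₀.base)
    (hΦd : Objectwise (fun M _ => IsDivisorial M) tf.divisorMonoid)
    (pullFrac : ∀ {A A' : tf.category} (_ : A' ⟶ A), tf.biratUnitsModel A → tf.biratUnitsModel A') :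
    (mkOfModel X tf hZ hP hBΛ DS IG gS gSs NH AB A₀ hA₀ hA₀').Prop43_iii pullFrac := by
  intro A B f P N R hA hB K h
  refine K.sNum_mul_sDen_inv_mem_mu hΦd (tf.isGroupLike_ratFnFunctor hBΛ)
    (fun A => MonoidHom.id (tf.biratUnitsModel A)) ?_ ?_ h
  · intro A B s' s'' h' h'' hb
    exact coe_fracOfModel_mul_unit tf hBΛ s' s''
  · intro A σ x
    exact coe_biratAutModel_eq_pull tf σ x

/-! ### The model instance with the disjoint-supports predicate of [FrdI] Prop. 4.1 (iii)

With `DisjointSupports a b := ∀ x, x ∣ a → x ∣ b → x = 1` ("every `x` with `x ≤ a`, `x ≤ b` is `0`",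
[FrdI] Prop. 4.1 (iii) — equivalent to disjointness of supports in a perfect perf-factorial monoid,
`IsPerfFactorial.forall_common_dvd_eq_one_iff_disjoint_supp`), both laws DS1 (cancellation:
`IsPerfFactorial.eq_of_mul_eq_mul_of_forall_common_dvd_eq_one`) and DS2 (transport along base-
isomorphisms) are THEOREMS, so Prop. 4.2 (i)(ii) hold for this instance of `mkOfModel` assuming only
that every `Φ(A)` is perf-factorial ([EtTh] Def. 3.6 (i)(ii): `Φ ⊆ Φ^{ℝ-log}` perf-factorial; `Φ`
perfect is part of the §4 setting). -/

/-- DS1 for the [FrdI] Prop. 4.1 (iii) predicate on a perfect perf-factorial `Φ(A)`.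
[cite: MochizukiFrdI2008, Prop. 4.1 (iii) p.76] -/
theorem ds_cancel_of_isPerfFactorial (tf : TemperedFrobenioid T D VD)
    (hpf : ∀ A : Dᵒᵖ, IsPerfFactorial (tf.Φ.carrier A)) (hP : ∀ A : Dᵒᵖ, IsPerfect (tf.Φ.carrier A))
    {A : Dᵒᵖ} {a b a' b' : tf.Φ.carrier A} (hab : ∀ x : tf.Φ.carrier A, x ∣ a → x ∣ b → x = 1)
    (hab' : ∀ x : tf.Φ.carrier A, x ∣ a' → x ∣ b' → x = 1) (e : a * b' = a' * b) :
    a = a' ∧ b = b' :=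
  (hpf A).eq_of_mul_eq_mul_of_forall_common_dvd_eq_one (hP A) hab hab' e

/-- DS2 for the [FrdI] Prop. 4.1 (iii) predicate: transport along pull-back by a base-isomorphism
(a multiplicative equivalence `Φ(A) ⥲ Φ(A')`). [cite: MochizukiFrdI2008, Prop. 4.1 (iii) p.76] -/
theorem ds_pull_of_isIso (tf : TemperedFrobenioid T D VD) {A A' : D} (e : A' ⟶ A) [IsIso e]
    {a b : tf.Φ.carrier (op A)} (hab : ∀ x : tf.Φ.carrier (op A), x ∣ a → x ∣ b → x = 1) :
    ∀ y : tf.Φ.carrier (op A'), y ∣ pull tf.divisorMonoid e a → y ∣ pull tf.divisorMonoid e b → y = 1 := by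
  let φ : tf.divisorMonoid.obj (op A) ≃* tf.divisorMonoid.obj (op A') :=
    MulEquiv.ofBijective (pull tf.divisorMonoid e) ⟨pull_injective e, fun x =>
      ⟨pull tf.divisorMonoid (inv e) x, pull_pull_inv_eq e x⟩⟩
  exact forall_common_dvd_eq_one_map_mulEquiv φ hab

/-- **[EtTh] Prop. 4.2 (i) for the model instance with the [FrdI] Prop. 4.1 (iii) disjoint-supports
predicate**: holds assuming only that every `Φ(A)` is (perfect and) perf-factorial.
[cite: MochizukiEtTh2009, Prop 4.2(i) p.88] -/
theorem prop42_i_mkOfModel_coprime (tf : TemperedFrobenioid T D VD) (hZ : tf.monoidType = MonoidType.Z)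
    (hP : ∀ A : Dᵒᵖ, IsPerfect (tf.Φ.carrier A)) (hBΛ : ∀ (Y : D₀ᵒᵖ) (b : T.BΛ.obj Y), IsUnit b)
    (IG : D → Prop) (gS : ∀ A : D, IG A → (X.Pi →* Aut A))
    (gSs : ∀ (A : D) (h : IG A), Function.Surjective (gS A h))
    (NH : Subgroup (Field.absoluteGaloisGroup K) → tf.category → ℕ+ → Prop)
    (AB : ∀ {A B : tf.category}, Subgroup (Aut A) → (A ⟶ A) → (A ⟶ B) → Prop) (A₀ : tf.category)
    (hA₀ : PreFrobenioid.IsFrobeniusTrivial tf.toElem A₀) (hA₀' : IG A₀.base)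
    (hpf : ∀ A : Dᵒᵖ, IsPerfFactorial (tf.Φ.carrier A)) :
    (mkOfModel X tf hZ hP hBΛ (fun {A} a b => ∀ x : tf.Φ.carrier A, x ∣ a → x ∣ b → x = 1) IG gS gSs NH
      AB A₀ hA₀ hA₀').Prop42_i :=
  prop42_i_mkOfModel X tf hZ hP hBΛ _ IG gS gSs NH AB A₀ hA₀ hA₀' (fun A => (hpf (op A)).isDivisorial)
    (fun hab hab' e => ds_cancel_of_isPerfFactorial tf hpf hP hab hab' e)

/-- **[EtTh] Prop. 4.2 (ii) for the model instance with the [FrdI] Prop. 4.1 (iii) disjoint-supports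
predicate** (necessity and uniqueness, as typed): holds assuming only that every `Φ(A)` is perf-factorial.
[cite: MochizukiEtTh2009, Prop 4.2(ii) p.88] -/
theorem prop42_ii_mkOfModel_coprime (tf : TemperedFrobenioid T D VD) (hZ : tf.monoidType = MonoidType.Z)
    (hP : ∀ A : Dᵒᵖ, IsPerfect (tf.Φ.carrier A)) (hBΛ : ∀ (Y : D₀ᵒᵖ) (b : T.BΛ.obj Y), IsUnit b)
    (IG : D → Prop) (gS : ∀ A : D, IG A → (X.Pi →* Aut A))
    (gSs : ∀ (A : D) (h : IG A), Function.Surjective (gS A h))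
    (NH : Subgroup (Field.absoluteGaloisGroup K) → tf.category → ℕ+ → Prop)
    (AB : ∀ {A B : tf.category}, Subgroup (Aut A) → (A ⟶ A) → (A ⟶ B) → Prop) (A₀ : tf.category)
    (hA₀ : PreFrobenioid.IsFrobeniusTrivial tf.toElem A₀) (hA₀' : IG A₀.base)
    (hpf : ∀ A : Dᵒᵖ, IsPerfFactorial (tf.Φ.carrier A)) :
    (mkOfModel X tf hZ hP hBΛ (fun {A} a b => ∀ x : tf.Φ.carrier A, x ∣ a → x ∣ b → x = 1) IG gS gSs NH
      AB A₀ hA₀ hA₀').Prop42_ii :=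
  prop42_ii_mkOfModel X tf hZ hP hBΛ _ IG gS gSs NH AB A₀ hA₀ hA₀' (fun A => (hpf (op A)).isDivisorial)
    (fun hab hab' e => ds_cancel_of_isPerfFactorial tf hpf hP hab hab' e)
    (fun e _ _ _ hab => ds_pull_of_isIso tf e hab)

end BiKummerSetting

end Literature.AnabelianGeometry.EtaleTheta

end
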